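import Summits.Ventures.WeilGRH.BaseRungOddTransfer
import Summits.Ventures.WeilGRH.DigammaHalfStep
import Literature.NumberTheory.LFunctions.WeilExplicitGL2
import Literature.NumberTheory.LFunctions.WeilArchimedeanMoments
import HarnessLib

/-!
# GL₂ base rung by TRANSFER: `WeilPositivityOnGL2 k N Λf ((log 2)/2)` for every even weight
# `k ≥ 2` and every level `N ≥ 17` (kernel-checked, from the `ζ` rung)

Cell `rh-explicit`, P-1 «A2-ext» (lead ruling R7-1 (2); producer seat rh-explicit-moll-step0-2).
The typed functional is `weilQuadraticGL2 k N Λf g` (weil-grh-1, `WeilExplicitGL2.lean`, the explicit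
formula of a weight-`k` level-`N` newform AS PRINTED, arXiv:1412.2990 Prop. 2.1 = Mestre 1986); on
the prime-free window `2a ≤ log 2` (`re_weilQuadraticGL2_of_tsupport_subset`, `Λf(0) = Λf(1) = 0`)
`Re Q_f(g) = N_g (log N − 2 log 2π) + (1/π) ∫ |ĝ(1/2+it)|² Re ψ(k/2 + it) dt`, `N_g = ‖g‖₂²`.

TRANSFER (no certificate, no new numerics): for even `k = 2m ≥ 2`,
`Re ψ(k/2 + it) ≥ Re ψ(1 + it) ≥ Re ψ(1/2 + it) = ½[Re ψ(1/4 + it/2) + Re ψ(3/4 + it/2)] + log 2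
 ≥ Re ψ(1/4 + it/2) + log 2`
(`DigammaHalfStep.lean`: half step and integer steps; duplication `digamma_add_digamma_add_half`;
`re_digamma_quarter_le_three_quarters`). With Plancherel `∫ |ĝ(1/2+it)|² dt = 2π N_g` and
Yoshida's `ζ` rung in analytic form `E(g) = 2 Re(ĝ(0) conj ĝ(1)) − (log π) N_g +
(1/2π) ∫ |ĝ|² Re ψ(1/4 + it/2) ≥ 0` (`weilArchQuadratic_nonneg`, kernel-checked certificate) and the
polar bound `2 Re(ĝ(0) conj ĝ(1)) ≤ 2(sinh a + a) N_g` (`weilPolar_re_le`):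
`Re Q_f(g) ≥ N_g (log N − 4(sinh a + a))`, `a ≤ (log 2)/2`.
At `a = (log 2)/2`: `4(sinh a + a) = 2(1/√2 + log 2) < 2.8006 < 45/16 < log 17`.

RESULTS: `weilPositivityOnGL2_of_log_level_ge` (any `a ≤ (log 2)/2`, `4(sinh a + a) ≤ log N`);
**`weilPositivityOnGL2_log_two_half_of_ge_17`**: `WeilPositivityOnGL2 k N Λf ((log 2)/2)` for even
`k ≥ 2`, `N ≥ 17`, `Λf 0 = Λf 1 = 0`. The producer's certificate (EXTREMALS/GL2-ext/base-rung-log2half-CERT,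
method M1) gives the sharp threshold `N ≥ 7` for `k = 2` and `N ≥ N₁(k)` for `k = 4..12`; the transfer
covers the ruling's named row `N = 37` (37a1/37b1) by the Lean kernel alone. Honest framing: this is
a window-positivity statement for the typed functional with a coefficient PARAMETER `Λf`; no claim about
zeros of modular `L`-functions is made (the tree has no such object).
-/

noncomputable section

open Complex Filter Set MeasureTheory
open scoped Real Topology ComplexConjugate

namespace Summit.Ventures.WeilGRH

open Literature.NumberTheory.LFunctions Literature.Analysis.SpecialFunctions.Complex

variable {g : ℝ → ℂ}

/-! ## The density comparison `Re ψ(1/4 + it/2) + log 2 ≤ Re ψ(m + it)` -/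

/-- Duplication at `s = 1/4 + it/2`: `Re ψ(1/4 + it/2) + Re ψ(3/4 + it/2) = 2 Re ψ(1/2 + it) − 2 log 2`.
[folklore] -/
theorem re_digamma_quarter_add_three_quarters (t : ℝ) :
    (digamma (1 / 4 + ((t / 2 : ℝ) : ℂ) * I)).re + (digamma (3 / 4 + ((t / 2 : ℝ) : ℂ) * I)).re =
      2 * (digamma (1 / 2 + t * I)).re - 2 * Real.log 2 := by
  set s : ℂ := 1 / 4 + ((t / 2 : ℝ) : ℂ) * I with hs
  have hne : ∀ m : ℕ, 2 * s ≠ -(m : ℂ) := by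
    intro m h
    have := congrArg Complex.re h
    simp [hs] at this
    linarith
  have hdup := digamma_add_digamma_add_half hne
  have h2s : 2 * s = 1 / 2 + t * I := by simp only [hs]; push_cast; ring
  have hs2 : s + 1 / 2 = 3 / 4 + ((t / 2 : ℝ) : ℂ) * I := by simp only [hs]; ring
  rw [h2s, hs2] at hdup
  have hlog : Complex.log 2 = ((Real.log 2 : ℝ) : ℂ) := by
    rw [show (2 : ℂ) = ((2 : ℝ) : ℂ) by norm_num, ← Complex.ofReal_log (by norm_num)]
  have := congrArg Complex.re hdup
  rw [add_re, hlog] at this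
  simp only [sub_re, mul_re, Complex.re_ofNat, Complex.im_ofNat, Complex.ofReal_re,
    Complex.ofReal_im, zero_mul, sub_zero] at this
  linarith

/-- **Density comparison (pointwise)**: `Re ψ(1/4 + it/2) + log 2 ≤ Re ψ(1/2 + it) ≤ Re ψ(1 + it) ≤
Re ψ(m + it)` for every integer `m ≥ 1` and real `t` — the GL₂ archimedean density of weight `2m`
dominates the `ζ` density by `log 2`. [folklore] -/
theorem re_digamma_quarter_add_log_two_le (t : ℝ) {m : ℕ} (hm : 1 ≤ m) :
    (digamma (1 / 4 + t / 2 * I)).re + Real.log 2 ≤ (digamma ((m : ℂ) + t * I)).re := by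
  have hq := re_digamma_quarter_le_three_quarters (t / 2)
  have hd := re_digamma_quarter_add_three_quarters t
  have hh := re_digamma_half_add_le_re_digamma_one_add t
  have hn := re_digamma_one_add_le_re_digamma_nat_add t hm
  have e : (1 / 4 + (t : ℂ) / 2 * I) = 1 / 4 + ((t / 2 : ℝ) : ℂ) * I := by push_cast; ring
  rw [e]
  linarith

/-! ## Integrability and the integral comparison -/

/-- Integrability of `t ↦ |ĝ(1/2+it)|² Re ψ(x + it)` for `x > 0`. [folklore] -/
theorem integrable_normSq_mul_re_digamma_line (hg : IsWeilTest g) {x : ℝ} (hx : 0 < x) :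
    Integrable fun t : ℝ ↦ ‖weilMellin g (1 / 2 + t * I)‖ ^ 2 * (digamma (x + t * I)).re := by
  have hI := integrable_weilMellin_mul_re_digamma (hg.weilConv hg.weilReflect) hx
  have hI' : Integrable fun t : ℝ ↦ ((‖weilMellin g (1 / 2 + t * I)‖ ^ 2 *
      (digamma (x + t * I)).re : ℝ) : ℂ) := by
    refine hI.congr (Eventually.of_forall fun t ↦ ?_)
    dsimp only
    rw [weilMellin_weilConv_weilReflect_half hg]
    push_cast
    ring
  exact hI'.re.congr (Eventually.of_forall fun t ↦ by
    simp only [RCLike.re_to_complex, Complex.ofReal_re])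

/-- **Density comparison (integrated)**: for a test function `g` and `m ≥ 1`,
`∫ |ĝ(1/2+it)|² Re ψ(1/4 + it/2) dt + 2π (log 2) ‖g‖₂² ≤ ∫ |ĝ(1/2+it)|² Re ψ(m + it) dt`
(pointwise comparison + Plancherel `∫ |ĝ(1/2+it)|² dt = 2π ‖g‖₂²`). [folklore] -/
theorem arch_integral_quarter_add_le (hg : IsWeilTest g) {m : ℕ} (hm : 1 ≤ m) :
    (∫ t : ℝ, ‖weilMellin g (1 / 2 + t * I)‖ ^ 2 * (digamma (1 / 4 + t / 2 * I)).re) +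
        2 * π * Real.log 2 * ∫ t : ℝ, ‖g t‖ ^ 2 ≤
      ∫ t : ℝ, ‖weilMellin g (1 / 2 + t * I)‖ ^ 2 * (digamma ((m : ℂ) + t * I)).re := by
  have h0 := integrable_normSq_mul_re_digamma hg (x := 1 / 4) (by norm_num)
  have e0 : ∀ t : ℝ, (((1 / 4 : ℝ) : ℂ) + t / 2 * I) = 1 / 4 + (t : ℂ) / 2 * I := by
    intro t; push_cast; ring
  simp_rw [e0] at h0
  have hm0 : (0 : ℝ) < m := by exact_mod_cast hm
  have h1 := integrable_normSq_mul_re_digamma_line hg hm0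
  have hP : ∫ t : ℝ, ‖weilMellin g (1 / 2 + t * I)‖ ^ 2 = 2 * π * ∫ t : ℝ, ‖g t‖ ^ 2 :=
    integral_norm_sq_weilMellin_half_line hg
  have hc : Integrable fun t : ℝ ↦ ‖weilMellin g (1 / 2 + t * I)‖ ^ 2 * Real.log 2 := by
    exact (integrable_norm_sq_weilMellin_half_line hg).mul_const (Real.log 2)
  have hsum : ∫ t : ℝ, (‖weilMellin g (1 / 2 + t * I)‖ ^ 2 * (digamma (1 / 4 + t / 2 * I)).re +
      ‖weilMellin g (1 / 2 + t * I)‖ ^ 2 * Real.log 2) =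
      (∫ t : ℝ, ‖weilMellin g (1 / 2 + t * I)‖ ^ 2 * (digamma (1 / 4 + t / 2 * I)).re) +
        2 * π * Real.log 2 * ∫ t : ℝ, ‖g t‖ ^ 2 := by
    rw [integral_add h0 hc, integral_mul_const, hP]
    ring
  rw [← hsum]
  refine integral_mono (h0.add hc) h1 fun t ↦ ?_
  have hpt := re_digamma_quarter_add_log_two_le t hm
  have hn : 0 ≤ ‖weilMellin g (1 / 2 + t * I)‖ ^ 2 := by positivity
  nlinarith

/-! ## The transfer theorems -/

/-- **GL₂ transfer of the `ζ` base rung.** For an even weight `k ≥ 2`, any level `N`, any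
coefficient function with `Λf 0 = Λf 1 = 0`, and a window `a ≤ (log 2)/2` with
`4(sinh a + a) ≤ log N`: `WeilPositivityOnGL2 k N Λf a`, i.e. `Re Q_f(g) ≥ 0` for every test
function supported in `[-a, a]`. Indeed `Re Q_f(g) ≥ ‖g‖₂² (log N − 4(sinh a + a))` by the density
comparison, Plancherel, Yoshida's `E(g) ≥ 0` and the polar bound. [cite: IwaniecKowalski2004, §5.5 Thm 5.12 (5.45) (the functional); Yoshida1992, Thm 1 (the `ζ` rung at `(log 2)/2`)] -/
theorem weilPositivityOnGL2_of_log_level_ge {k N : ℕ} {Λf : ℕ → ℂ} (hk : Even k) (hk2 : 2 ≤ k)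
    (h0 : Λf 0 = 0) (h1 : Λf 1 = 0) {a : ℝ} (ha : a ≤ Real.log 2 / 2)
    (hN : 4 * (Real.sinh a + a) ≤ Real.log N) :
    WeilPositivityOnGL2 k N Λf a := by
  intro g hg hsupp
  obtain ⟨m, hkm⟩ := hk
  have hm : 1 ≤ m := by omega
  have hsupp2 : tsupport g ⊆ Icc (-(Real.log 2 / 2)) (Real.log 2 / 2) :=
    hsupp.trans (Icc_subset_Icc (by linarith) ha)
  set Ng : ℝ := ∫ t : ℝ, ‖g t‖ ^ 2 with hNg
  set A0 : ℝ := ∫ t : ℝ, ‖weilMellin g (1 / 2 + t * I)‖ ^ 2 *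
      (digamma (1 / 4 + t / 2 * I)).re with hA0
  set Am : ℝ := ∫ t : ℝ, ‖weilMellin g (1 / 2 + t * I)‖ ^ 2 *
      (digamma ((m : ℂ) + t * I)).re with hAm
  set P : ℝ := 2 * (weilMellin g 0 * conj (weilMellin g 1)).re with hP
  -- the GL₂ functional on the prime-free window
  have hQ := re_weilQuadraticGL2_of_tsupport_subset (k := k) (N := N) h0 h1 hg hsupp (by linarith)
  have hk2c : ∀ t : ℝ, ((k : ℂ) / 2 + t * I) = ((m : ℂ) + t * I) := by
    intro t; rw [hkm]; push_cast; ring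
  simp_rw [hk2c] at hQ
  -- the `ζ` rung (Yoshida, kernel-checked) and the polar bound
  have hE : 0 ≤ weilArchQuadratic g := weilArchQuadratic_nonneg hg hsupp2
  rw [weilArchQuadratic_eq] at hE
  change 0 ≤ P - Real.log π * Ng + 1 / (2 * π) * A0 at hE
  have hPle : P ≤ 2 * (Real.sinh a + a) * Ng := weilPolar_re_le hg hsupp
  -- the density comparison
  have hA : A0 + 2 * π * Real.log 2 * Ng ≤ Am := arch_integral_quarter_add_le hg hm
  have hNg0 : 0 ≤ Ng := integral_nonneg fun t ↦ by positivity
  have hπ : 0 < π := Real.pi_pos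
  have hlog2π : Real.log (2 * π) = Real.log 2 + Real.log π :=
    Real.log_mul (by norm_num) hπ.ne'
  rw [hQ, hlog2π]
  -- `Re Q ≥ Ng (log N − 4 (sinh a + a)) ≥ 0`
  have h1 : 1 / π * Am ≥ 1 / π * (A0 + 2 * π * Real.log 2 * Ng) :=
    mul_le_mul_of_nonneg_left hA (by positivity)
  have h2 : 1 / π * (A0 + 2 * π * Real.log 2 * Ng) = 2 * (1 / (2 * π) * A0) + 2 * Real.log 2 * Ng := by
    field_simp
  have h3 : 1 / (2 * π) * A0 ≥ Real.log π * Ng - P := by linarith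
  nlinarith [mul_le_mul_of_nonneg_right hN hNg0]

/-- Numerics of the base rung: `4(sinh((log 2)/2) + (log 2)/2) = 2(1/√2 + log 2) < 45/16 < log 17`
(`1/√2 < 0.70711`, `log 2 < 0.6931471808`, `e^{45} < 2.7182818286^{45} < 17^{16}`). [folklore] -/
theorem four_mul_sinh_log_two_half_add_le_log_17 :
    4 * (Real.sinh (Real.log 2 / 2) + Real.log 2 / 2) ≤ Real.log 17 := by
  have hs : 4 * (Real.sinh (Real.log 2 / 2) + Real.log 2 / 2) = 2 * (1 / Real.sqrt 2 + Real.log 2) := by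
    have h := two_mul_sinh_log_two_half_add
    linarith
  rw [hs]
  -- `1/√2 < 0.70711`
  have hs2 : (1.41421 : ℝ) < Real.sqrt 2 := by
    rw [show (1.41421 : ℝ) = Real.sqrt (1.41421 ^ 2) by rw [Real.sqrt_sq (by norm_num)]]
    exact Real.sqrt_lt_sqrt (by norm_num) (by norm_num)
  have h1 : 1 / Real.sqrt 2 < 0.70711 := by
    rw [div_lt_iff₀ (by positivity)]
    nlinarith
  have h2 : Real.log 2 < 0.6931471808 := Real.log_two_lt_d9
  -- `45/16 < log 17`
  have he : Real.exp 1 < 2.7182818286 := Real.exp_one_lt_d9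
  have h45 : Real.exp 45 < 17 ^ 16 := by
    have h' : Real.exp 45 = Real.exp 1 ^ 45 := by rw [← Real.exp_nat_mul]; norm_num
    rw [h']
    have hp : Real.exp 1 ^ 45 < (2.7182818286 : ℝ) ^ 45 :=
      pow_lt_pow_left₀ he (Real.exp_pos 1).le (by norm_num)
    have hn : (2.7182818286 : ℝ) ^ 45 < 17 ^ 16 := by norm_num
    linarith
  have h3 : (45 / 16 : ℝ) < Real.log 17 := by
    rw [Real.lt_log_iff_exp_lt (by norm_num)]
    have hpow : Real.exp (45 / 16) ^ 16 = Real.exp 45 := by rw [← Real.exp_nat_mul]; norm_num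
    have hlt : Real.exp (45 / 16) ^ 16 < (17 : ℝ) ^ 16 := by rw [hpow]; exact h45
    exact lt_of_pow_lt_pow_left₀ 16 (by norm_num) hlt
  linarith

/-- **The GL₂ base rung for every even weight `k ≥ 2` and every level `N ≥ 17`, by transfer**:
`WeilPositivityOnGL2 k N Λf ((log 2)/2)` whenever `Λf 0 = Λf 1 = 0` — `Re Q_f(g) ≥ 0` for every
smooth `g` supported in `[-(log 2)/2, (log 2)/2]` (in particular for the explicit-formula coefficients
of any weight-2 newform of level `37`, the ruling's named row; the producer's certificate gives the
sharp threshold `N ≥ 7`). [cite: IwaniecKowalski2004, §5.5 Thm 5.12 (5.45); Yoshida1992, Thm 1] -/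
theorem weilPositivityOnGL2_log_two_half_of_ge_17 {k N : ℕ} {Λf : ℕ → ℂ} (hk : Even k)
    (hk2 : 2 ≤ k) (hN : 17 ≤ N) (h0 : Λf 0 = 0) (h1 : Λf 1 = 0) :
    WeilPositivityOnGL2 k N Λf (Real.log 2 / 2) := by
  refine weilPositivityOnGL2_of_log_level_ge hk hk2 h0 h1 le_rfl ?_
  have hlogN : Real.log 17 ≤ Real.log N :=
    Real.log_le_log (by norm_num) (by exact_mod_cast hN)
  linarith [four_mul_sinh_log_two_half_add_le_log_17]

/-- Every smaller window follows: `WeilPositivityOnGL2 k N Λf a` for all `a ≤ (log 2)/2`, even `k ≥ 2`,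
`N ≥ 17`. [cite: IwaniecKowalski2004, §5.5 Thm 5.12 (5.45); Yoshida1992, Thm 1] -/
theorem weilPositivityOnGL2_of_le_log_two_half_of_ge_17 {k N : ℕ} {Λf : ℕ → ℂ} (hk : Even k)
    (hk2 : 2 ≤ k) (hN : 17 ≤ N) (h0 : Λf 0 = 0) (h1 : Λf 1 = 0) {a : ℝ}
    (ha : a ≤ Real.log 2 / 2) : WeilPositivityOnGL2 k N Λf a := fun g hg hsupp ↦
  weilPositivityOnGL2_log_two_half_of_ge_17 hk hk2 hN h0 h1 g hg
    (hsupp.trans (Icc_subset_Icc (by linarith) ha))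

end Summit.Ventures.WeilGRH

end
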